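import Summits.CriticalPhenomena.CardyFormulaZ2.Theorems.CardyRotToConfR2SymmetryUpgradeSleSixIsometryInvariance

/-!
# Stub S4a (`stub_slePreservingIsMoebius`) of line `isotropy-kills-beltrami`: tightness and the group of SLE₆-preserving homeomorphisms

Refuter by-product (drefute, gen 2) on crux `CardyRotToConfR2SymmetryUpgrade`
(stmt-CriticalPhenomena-0698). Stub S4a says: a plane homeomorphism `T` pushing the chordal SLE₆
law of EVERY Dobrushin domain `D` to the chordal SLE₆ law of `T D` is a similarity `z ↦ c z + w`
or an anti-similarity `z ↦ c z̄ + w`.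

Recorded here (sorry-free, no new definitions):

* `slePreserving_refl`, `slePreserving_trans`, `slePreserving_symm` — the SLE₆-preserving
  homeomorphisms form a GROUP (uniqueness `IsSLELaw.unique'` and existence
  `exists_isSLELaw_of_ne_eight` of the SLE₆ law; functoriality of `MarkedDomain.map` /
  `CurveClass.map`). With the landed S4c (`stub_sleSixIsometryInvariance`) this group contains all
  (anti)similarities, so S4a states exactly that it IS the group of (anti)similarities; in
  particular the hypothesis of S4a is not vacuous and S4a cannot be refuted "for lack of instances".
* `conjLIE_toHomeomorph_ne_similarity`, `not_slePreserving_isSimilarity` — TIGHTNESS: the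
  orientation-reversing disjunct of S4a's conclusion cannot be dropped. Complex conjugation
  preserves all SLE₆ laws (`isSLELaw_map_conj`, reflection symmetry of SLE₆) and is not an
  orientation-preserving similarity. So the natural strengthening "SLE₆-preserving ⇒ similarity"
  is FALSE, and the glue `isotropyRigidity_of_stubs` genuinely needs its anti-similarity branch.
-/

noncomputable section

open MeasureTheory Set

namespace Summit.CriticalPhenomena.CardyFormulaZ2.Theorems.CardyRotToConfR2SymmetryUpgrade.Negative

open Literature.Probability.RandomPlanarGeometry
open Summit.CriticalPhenomena.CardyFormulaZ2.Theorems.CardyRotToConfR2SymmetryUpgrade.IsotropyKillsBeltrami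
open scoped ComplexConjugate

/-! ### Bookkeeping: identity homeomorphism -/

/-- `MarkedDomain.map` along the identity homeomorphism is the identity. [folklore] -/
theorem markedDomain_map_refl' {n : ℕ} (D : MarkedDomain n) : D.map (Homeomorph.refl ℂ) = D :=
  MarkedDomain.ext (JordanDomain.ext (by simp) rfl) rfl

/-- `CurveClass.map` along the identity homeomorphism is the identity. [folklore] -/
theorem curveClassMap_refl' : CurveClass.map ((Homeomorph.refl ℂ : ℂ ≃ₜ ℂ) : C(ℂ, ℂ)) = id := by
  funext c
  obtain ⟨γ, rfl⟩ := CurveClass.surjective_mk c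
  rw [CurveClass.map_mk, id]
  congr 1

/-! ### The SLE₆-preserving homeomorphisms form a group -/

/-- The identity preserves SLE₆ laws. [folklore] -/
theorem slePreserving_refl :
    ∀ (D : DobrushinDomain) (μ : Measure (CurveClass ℂ)), IsSLELaw 6 D μ →
      IsSLELaw 6 (D.map (Homeomorph.refl ℂ))
        (μ.map (CurveClass.map ((Homeomorph.refl ℂ : ℂ ≃ₜ ℂ) : C(ℂ, ℂ)))) := by
  intro D μ hμ
  rwa [markedDomain_map_refl', curveClassMap_refl', Measure.map_id]

/-- SLE₆-preserving homeomorphisms are closed under composition (`Homeomorph.trans f g = g ∘ f`).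
[folklore] -/
theorem slePreserving_trans {T₁ T₂ : ℂ ≃ₜ ℂ}
    (h₁ : ∀ (D : DobrushinDomain) (μ : Measure (CurveClass ℂ)), IsSLELaw 6 D μ →
      IsSLELaw 6 (D.map T₁) (μ.map (CurveClass.map (T₁ : C(ℂ, ℂ)))))
    (h₂ : ∀ (D : DobrushinDomain) (μ : Measure (CurveClass ℂ)), IsSLELaw 6 D μ →
      IsSLELaw 6 (D.map T₂) (μ.map (CurveClass.map (T₂ : C(ℂ, ℂ))))) :
    ∀ (D : DobrushinDomain) (μ : Measure (CurveClass ℂ)), IsSLELaw 6 D μ →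
      IsSLELaw 6 (D.map (T₁.trans T₂))
        (μ.map (CurveClass.map ((T₁.trans T₂ : ℂ ≃ₜ ℂ) : C(ℂ, ℂ)))) := by
  intro D μ hμ
  have h := h₂ _ _ (h₁ D μ hμ)
  rwa [MarkedDomain.map_map,
    Measure.map_map (CurveClass.measurable_map _) (CurveClass.measurable_map _),
    ← CurveClass.map_homeomorph_trans] at h

/-- SLE₆-preserving homeomorphisms are closed under inverses (this uses EXISTENCE of the SLE₆ law
of `T⁻¹ D`, `exists_isSLELaw_of_ne_eight`, and uniqueness `IsSLELaw.unique'`). [folklore] -/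
theorem slePreserving_symm {T : ℂ ≃ₜ ℂ}
    (h : ∀ (D : DobrushinDomain) (μ : Measure (CurveClass ℂ)), IsSLELaw 6 D μ →
      IsSLELaw 6 (D.map T) (μ.map (CurveClass.map (T : C(ℂ, ℂ))))) :
    ∀ (D : DobrushinDomain) (μ : Measure (CurveClass ℂ)), IsSLELaw 6 D μ →
      IsSLELaw 6 (D.map T.symm) (μ.map (CurveClass.map (T.symm : C(ℂ, ℂ)))) := by
  intro D μ hμ
  obtain ⟨ν, hν⟩ :=
    exists_isSLELaw_of_ne_eight (κ := 6) (by norm_num) (by norm_num) (D.map T.symm)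
  have h' := h _ _ hν
  rw [MarkedDomain.map_map, Homeomorph.symm_trans_self, markedDomain_map_refl'] at h'
  have hνμ : ν.map (CurveClass.map (T : C(ℂ, ℂ))) = μ := h'.unique' hμ
  have hμν : μ.map (CurveClass.map (T.symm : C(ℂ, ℂ))) = ν := by
    rw [← hνμ, Measure.map_map (CurveClass.measurable_map _) (CurveClass.measurable_map _),
      ← CurveClass.map_homeomorph_trans, Homeomorph.self_trans_symm, curveClassMap_refl',
      Measure.map_id]
  rw [hμν]
  exact hν

/-- Hence every (anti)similarity AND its conjugates by any SLE₆-preserving `T` preserve SLE₆ laws;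
in particular the hypothesis of S4a is inhabited by non-trivial maps (S4c, landed). [folklore] -/
theorem slePreserving_conjLIE :
    ∀ (D : DobrushinDomain) (μ : Measure (CurveClass ℂ)), IsSLELaw 6 D μ →
      IsSLELaw 6 (D.map Complex.conjLIE.toHomeomorph)
        (μ.map (CurveClass.map ((Complex.conjLIE.toHomeomorph : ℂ ≃ₜ ℂ) : C(ℂ, ℂ)))) :=
  fun D μ hμ => isSLELaw_map_conj D μ hμ

/-! ### Tightness: the anti-similarity disjunct of S4a cannot be dropped -/

/-- Complex conjugation is not an orientation-preserving similarity `z ↦ c z + w`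
(evaluate at `0`, `1`, `i`). [folklore] -/
theorem conjLIE_toHomeomorph_ne_similarity (c : ℂ) (hc : c ≠ 0) (w : ℂ) :
    (Complex.conjLIE.toHomeomorph : ℂ ≃ₜ ℂ) ≠ similarity c hc w := by
  intro h
  have h0 : conj (0 : ℂ) = c * 0 + w := by
    simpa only [conjLIE_toHomeomorph_apply, similarity_apply] using
      congrArg (fun f : ℂ ≃ₜ ℂ => f 0) h
  have h1 : conj (1 : ℂ) = c * 1 + w := by
    simpa only [conjLIE_toHomeomorph_apply, similarity_apply] using
      congrArg (fun f : ℂ ≃ₜ ℂ => f 1) h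
  have hI : conj Complex.I = c * Complex.I + w := by
    simpa only [conjLIE_toHomeomorph_apply, similarity_apply] using
      congrArg (fun f : ℂ ≃ₜ ℂ => f Complex.I) h
  have hw : w = 0 := by simpa using h0.symm
  have hc1 : c = 1 := by
    rw [hw, add_zero, mul_one, map_one] at h1
    exact h1.symm
  rw [hw, hc1, add_zero, one_mul, Complex.conj_I] at hI
  have him := congrArg Complex.im hI
  norm_num at him

/-- **Tightness of S4a.** The strengthening of `stub_slePreservingIsMoebius` whose conclusion keeps
only the orientation-PRESERVING similarities is false: complex conjugation preserves every chordal
SLE₆ law (`isSLELaw_map_conj`, the reflection half of the landed S4c) and is not of the form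
`z ↦ c z + w`. [folklore] -/
theorem not_slePreserving_isSimilarity :
    ¬ ∀ T : ℂ ≃ₜ ℂ,
      (∀ (D : DobrushinDomain) (μ : Measure (CurveClass ℂ)), IsSLELaw 6 D μ →
        IsSLELaw 6 (D.map T) (μ.map (CurveClass.map (T : C(ℂ, ℂ))))) →
      ∃ (c : ℂ) (hc : c ≠ 0) (w : ℂ), T = similarity c hc w := by
  intro h
  obtain ⟨c, hc, w, hT⟩ := h _ slePreserving_conjLIE
  exact conjLIE_toHomeomorph_ne_similarity c hc w hT

end Summit.CriticalPhenomena.CardyFormulaZ2.Theorems.CardyRotToConfR2SymmetryUpgrade.Negative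

end
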